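import Summits.KontsevichZagierPeriods.KontsevichZagierPeriods.Theorems.FermatIsogenyDeepWordSectorP11
import Literature.NumberTheory.Transcendental.KZDirichletCharts
import Summits.KontsevichZagierPeriods.KontsevichZagierPeriods.Theorems.HermiteRigidityCMTwistQuasiPeriodTransferMoves

/-! # `FermatIsogenyDeepWordSectorBP1` — part 1/6 of the mechanical ≤400-line split of `B_src.lean` (sha256 9cb321caf3c881c0…)
Source: decomp-kz lens-5 g22 DeepWordSectorB.lean v4 @d2f1e37a (levels 3/4 closed hypothesis-free, Dirichlet move proved, level 6 from the linear rung; critic CLEARED g7-5 l.1397 / g7-7 l.1406); --supports stmt-KontsevichZagierPeriods-3898.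
Split by census-1 g10 `gen/splitlean.py`: scopes re-opened with their `open`/`variable`/`set_option` context; mathematics and declaration order unchanged. -/

/-!
# FermatIsogeny deep targets — B-file: LEVELS 3 AND 4 CLOSED, LEVEL 6 FROM THE ROUTE'S LINEAR RUNG (decomp-kz · lens-5 · g22 · addenda 4, 5, 6)

This file is the continuation of the node module `DeepWordSector.lean` (v10, sha256 5e8cd5c1…) once it has LANDED as
`Summits/KontsevichZagierPeriods/KontsevichZagierPeriods/Theorems/FermatIsogenyDeepWordSector.lean` (writer landing call, critic g6-16:
«the next addendum should open DeepWordSectorB.lean importing the landed module rather than grow this file»).  LANDER: if the node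
module lands split into parts, replace the FIRST import above by the LAST part (the body uses `bcl`, `kc`, `kc_pow`, `bcl_symm`,
`betaReflectionMove_holds`, `bcl_rat_one`, `bcl_one_one`, `word_class`, `word_class_const`, `word_value`, `word_value_const`, `bval`,
`bval_pos`, `lvl`, `lvl_bounds`, `letterMult`, `pairMult`, `SameType`, `BoxChain`, `BetaWordSectorLevel`, `RohrlichHodgeAt`,
`betaWordSectorLevel_iff_of_rohrlichHodgeAt`, `rohrlichHodgeAt_three_of_chudnovsky`, `ChudnovskyGammaThird/Quarter`,
`betaProductSector_iff_baseRange_of_chudnovsky`, `sum_Ico_one_three`, `isAlgebraic_ratCast`).  The SECOND import is a tree module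
(`KZDirichletCharts`: Dirichlet's two charts of the simplex, PROVED; builds on the farm, rc 0) not in the node module's cone; the THIRD is
the tree Theorems module `HermiteRigidityCMTwistQuasiPeriodTransferMoves` (PROVED, builds rc 0: the split rule and the 1-variable
change-of-variables packaging used by the vendored Legendre moves of addendum 5).
FARM EVIDENCE BEFORE LANDING: `scratch/ProbeB5.lean` (sha256 8642a49e…) = the node file v10 + the second and third imports + THIS BODY
inlined before its final `end` — farm rc 0, 0 errors, 0 warnings, 0 sorries (`DeepWordSectorB.probeB5.leancheck.json`); `--axioms
boxChain_six_of_linear` (ProbeB5), `--axioms boxChain_four` (ProbeB4), `--axioms betaDirichletMove_holds` (ProbeB2) and `#print axioms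
boxChain_three / bcl_dirichlet / betaProductSector_iff_of_chudnovsky / boxChain_three_of_dirichlet / sameType_three_iff / boxChain_four / bcl_dup /
sameType_four_iff / betaWordSectorLevel_four_of_chudnovsky / betaProductSector_iff_level_six_of_chudnovsky / boxChain_six_of_linear /
sameType_six_iff / relation_six / betaProductSector_iff_shadow_of_chudnovsky_linear` = [propext, Classical.choice, Quot.sound] pinned by
`#guard_msgs` in the probe.

CONTENT: section `LevelThreeChains` — `BetaDirichletMove` (Dirichlet's formula typed as a KZ-equivalence of 2-letter words) and
`boxChain_three_of_dirichlet : BetaDirichletMove → ∀ k, BoxChain k 3 (SameType 3)` (normal form `nf3`, type criterion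
`sameType_three_iff`); section `DirichletHolds` — **`betaDirichletMove_holds : BetaDirichletMove`** and **`bcl_dirichlet`** (Dirichlet in
`P`) FROM THE TREE's charts, hence **`boxChain_three : ∀ k, BoxChain k 3 (SameType 3)` UNCONDITIONALLY**,
`betaWordSectorLevel_three_of_chudnovsky : ChudnovskyGammaThird → ∀ k, BetaWordSectorLevel k 3` and
`betaProductSector_iff_of_chudnovsky` (crux 3898's base range = the level-4 and level-6 chain statements, modulo the two printed
Chudnovsky theorems — themselves tree theorems `algebraicIndependent_real_pi_gamma_one_third/_quarter`, pending farm build).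
ADDENDUM 5: namespace `BetaMoves` (continued) — Legendre's duplication as two KZ moves (`betaSymm_fold`, `betaFold_duplication`,
VENDORED from the route's unbuilt Theorems `FermatIsogenyBetaLinearSectorQuartersStubBetaFold/StubBetaDuplication`); section
`Legendre` — **`bcl_dup : bcl a a = κ(2^{1−2a})·bcl a ½`** in `P`; section `LevelFourChains` — the sixteen level-4 letters over
`X = β(½,½)`, `Y = β(¼,½)`, `Z = β(¾,¾)` with constants in `⟨ℚ, √2⟩`, the relation `Y·Z = κ(2√2)·X` (`dirichlet_four_rel`),
`hodgeType_four_iff`, `sameType_four_iff`, hence **`boxChain_four : ∀ k, BoxChain k 4 (SameType 4)` UNCONDITIONALLY**,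
`betaWordSectorLevel_four_of_chudnovsky : ChudnovskyGammaQuarter → ∀ k, BetaWordSectorLevel k 4` and
`betaProductSector_iff_level_six_of_chudnovsky` (crux 3898's base range = the ONE level-6 chain statement, modulo Chudnovsky).
ADDENDUM 6: section `LevelSixChains` — the route's linear rung at level 6 typed VERBATIM as `BetaLinearSixths` (= the statement of the TREE
THEOREM `BetaLinearSector.SixthsMax.betaLinearSector_sixths`, proved; module pending farm build), the transfer lemma
`bcl_eq_kc_mul_of_linear`, the twelve Γ-value identities `gammaSix_ij`, the thirty-six level-6 letters over `X = β(½,½)`, `A = β(⅓,½)`,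
`C = β(⅔,½)` with constants in `⟨ℚ, √3, 2^{1/3}⟩` (`letter_six`), the relation `A·C = κ(2√3)·X` (`relation_six`), `hodgeType_six_iff`,
`sameType_six_iff`, hence **`boxChain_six_of_linear : BetaLinearSixths → ∀ k, BoxChain k 6 (SameType 6)`** ("linear ⇒ all word lengths"),
`betaWordSectorLevel_six_of_chudnovsky_linear : ChudnovskyGammaThird → BetaLinearSixths → ∀ k, BetaWordSectorLevel k 6` and
**`betaProductSector_iff_shadow_of_chudnovsky_linear`**: crux 3898 ⟺ the pure Rohrlich shadow `∀ N, 5 ≤ N → N ≠ 6 → BetaWordSectorLevel 2 N`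
modulo three tree theorems pending build.
-/

noncomputable section

namespace Summit.KontsevichZagierPeriods.FermatIsogeny.DeepTargets

open Literature.NumberTheory.Transcendental MeasureTheory
open Summit.KontsevichZagierPeriods.KontsevichZagierPeriods.Theses.FermatIsogeny (BetaLinearSector BetaProductSector FermatSectorComplete)
open Literature.NumberTheory.Transcendental MeasureTheory in
open Summit.KontsevichZagierPeriods.KontsevichZagierPeriods.Theses.FermatIsogeny (BetaLinearSector BetaProductSector FermatSectorComplete) in
/-- Rational numbers are real algebraic. [bookkeeping] -/
private theorem isAlgebraic_ratCast (x : ℚ) : IsAlgebraic ℚ (x : ℝ) := by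
  have h := isAlgebraic_algebraMap (R := ℚ) (A := ℝ) x
  rwa [eq_ratCast] at h

/-! ## B · LEVEL-3 CHAINS MODULO ONE TYPED MOVE (g22 addendum 4; body of `DeepWordSectorB.lean`)

Instrument 2 (`instrument/class_reps.md`): at level 3 all same-type classes of 2-letter words are connected by symmetry, unit letters,
translation and ONE Dirichlet instance `B(⅓,⅓)B(⅔,⅔) ∼ B(⅓,⅔)B(⅓,1)`.  Here this is made a THEOREM FOR EVERY WORD LENGTH `k`:
`BetaDirichletMove → BoxChain k 3 (SameType 3)` (`boxChain_three_of_dirichlet`), where `BetaDirichletMove` is Dirichlet's formula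
`B(a,b)B(a+b,c) = B(b,c)B(a,b+c)` TYPED as a KZ-equivalence of 2-letter words (PROVED in section `DirichletHolds` below from the tree's `KZDirichletCharts`: the polar
chart `(u,v) ↦ (uv,u(1−v))` of the simplex by the square, Jacobian `u`, then the linear chart `(t,u) ↦ (u,(1−u)t)`).  With the node's
`betaWordSectorLevel_iff_of_rohrlichHodgeAt` and `rohrlichHodgeAt_three_of_chudnovsky`:
  `ChudnovskyGammaThird → BetaDirichletMove → ∀ k, BetaWordSectorLevel k 3`  (`betaWordSectorLevel_three_of_dirichlet`)
— the whole LEVEL-3 SLICE of cruxes 3897/3898 (indeed of every `k`-letter sector) reduces to one concrete 2-variable change of variables.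
Mechanism: in `P`, level-3 letters are `κ(c)·X^x Y^y Z^z` with `X = β(⅓,⅔)`, `Y = β(⅓,⅓)`, `Z = β(⅔,⅔)`; the move gives `Y·Z = κ(3)·X`;
DKO type 0 ⟺ `(x+z, y−z)` agree; and in any commutative ring `YZ = TX ∧ x+z = x'+z' ∧ y−z = y'−z' ⟹ T^{z'}·XʸYʸZᶻ-word = T^{z}·word'`
(`nf3`), applied once in `P` (classes) and once in `ℝ` (values). -/
section LevelThreeChains

/-- **The Dirichlet move, typed** (PROVED below: `betaDirichletMove_holds`, section `DirichletHolds`): for rational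
`a, b, c > 0` the 2-letter words with exponent rows `(a,b),(a+b,c)` and `(b,c),(a,b+c)` on the open square are KZ-equivalent.
Value identity `B(a,b)B(a+b,c) = Γ(a)Γ(b)Γ(c)/Γ(a+b+c) = B(b,c)B(a,b+c)`. (cite AndrewsAskeyRoy1999, Thm 1.8.6 (Dirichlet)) -/
def BetaDirichletMove : Prop :=
  ∀ (a b c : ℚ), 0 < a → 0 < b → 0 < c → ∀ (ρ ρ' : KZ.IntegralRep 2),
    ρ.domain = {x | ∀ i, x i ∈ Set.Ioo (0:ℝ) 1} →
    Set.EqOn ρ.integrand (fun x => ∏ i, (x i) ^ (((![a, a + b] : Fin 2 → ℚ) i : ℝ) - 1)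
        * (1 - x i) ^ (((![b, c] : Fin 2 → ℚ) i : ℝ) - 1)) ρ.domain →
    ρ'.domain = {x | ∀ i, x i ∈ Set.Ioo (0:ℝ) 1} →
    Set.EqOn ρ'.integrand (fun x => ∏ i, (x i) ^ (((![b, a] : Fin 2 → ℚ) i : ℝ) - 1)
        * (1 - x i) ^ (((![c, b + c] : Fin 2 → ℚ) i : ℝ) - 1)) ρ'.domain →
    KZ.Equivalent ρ ρ'

/-! #### rational constants in `P` without proof arguments -/

/-- `κ(q)` for a rational `q`. [bookkeeping] -/
noncomputable def kcQ (q : ℚ) : KZ.FormalPeriodRing := kc (q : ℝ) (isAlgebraic_ratCast q)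

/-- Auxiliary step `kcQ_one`: kc Q one. [bookkeeping] -/
theorem kcQ_one : kcQ 1 = 1 := by
  rw [kcQ, ← kc_one]; exact kc_congr _ _ (by norm_num)

/-- Auxiliary step `kcQ_mul`: kc Q mul. [bookkeeping] -/
theorem kcQ_mul (a b : ℚ) : kcQ (a * b) = kcQ a * kcQ b := by
  rw [kcQ, kcQ, kcQ, ← kc_mul]; exact kc_congr _ _ (by push_cast; rfl)

/-- Auxiliary step `kcQ_pow`: kc Q pow. [bookkeeping] -/
theorem kcQ_pow (a : ℚ) (n : ℕ) : kcQ a ^ n = kcQ (a ^ n) := by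
  rw [kcQ, kcQ, kc_pow]; exact kc_congr _ _ (by push_cast; rfl)

/-- Auxiliary step `kcQ_prod`: kc Q prod. [bookkeeping] -/
theorem kcQ_prod {ι : Type*} (s : Finset ι) (f : ι → ℚ) : ∏ i ∈ s, kcQ (f i) = kcQ (∏ i ∈ s, f i) := by
  classical
  refine Finset.induction_on s (by simp [kcQ_one]) ?_
  intro j s hj ih
  rw [Finset.prod_insert hj, Finset.prod_insert hj, ih, kcQ_mul]

/-- Auxiliary step `evalP_kcQ`: eval P kc Q. [bookkeeping] -/
@[simp] theorem evalP_kcQ (q : ℚ) : KZ.evalP (kcQ q) = q := evalP_kc _ _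

/-- Auxiliary step `kcQ_three_inv_mul`: kc Q three inv mul. [bookkeeping] -/
theorem kcQ_three_inv_mul : kcQ (1/3) * kcQ 3 = 1 := by
  rw [← kcQ_mul, show (1/3 : ℚ) * 3 = 1 by norm_num, kcQ_one]

/-! #### the nine level-3 letters -/

/-- Auxiliary step `fin3_cases`: fin3 cases. [bookkeeping] -/
private theorem fin3_cases (x : Fin 3) : x = 0 ∨ x = 1 ∨ x = 2 := by
  fin_cases x <;> simp

/-- exponent of `X = β(⅓,⅔)` in a letter. [bookkeeping] -/
def xExp3 (x y : Fin 3) : ℕ := if (x.val = 0 ∧ y.val = 1) ∨ (x.val = 1 ∧ y.val = 0) then 1 else 0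
/-- exponent of `Y = β(⅓,⅓)`. [bookkeeping] -/
def yExp3 (x y : Fin 3) : ℕ := if x.val = 0 ∧ y.val = 0 then 1 else 0
/-- exponent of `Z = β(⅔,⅔)`. [bookkeeping] -/
def zExp3 (x y : Fin 3) : ℕ := if x.val = 1 ∧ y.val = 1 then 1 else 0
/-- the rational constant of a letter: `β(⅓,1) = β(1,⅓) = 3`, `β(⅔,1) = β(1,⅔) = 3/2`, `β(1,1) = 1`, else `1`. [bookkeeping] -/
def cst3 (x y : Fin 3) : ℚ :=
  if (x.val = 0 ∧ y.val = 2) ∨ (x.val = 2 ∧ y.val = 0) then 3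
  else if (x.val = 1 ∧ y.val = 2) ∨ (x.val = 2 ∧ y.val = 1) then 3/2 else 1

/-- Auxiliary definition `xCount3`: x Count3. [bookkeeping] -/
def xCount3 {k : ℕ} (u v : Fin k → Fin 3) : ℕ := ∑ i, xExp3 (u i) (v i)
/-- Auxiliary definition `yCount3`: y Count3. [bookkeeping] -/
def yCount3 {k : ℕ} (u v : Fin k → Fin 3) : ℕ := ∑ i, yExp3 (u i) (v i)
/-- Auxiliary definition `zCount3`: z Count3. [bookkeeping] -/
def zCount3 {k : ℕ} (u v : Fin k → Fin 3) : ℕ := ∑ i, zExp3 (u i) (v i)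
/-- Auxiliary definition `cstW3`: cst W3. [bookkeeping] -/
def cstW3 {k : ℕ} (u v : Fin k → Fin 3) : ℚ := ∏ i, cst3 (u i) (v i)

/-- Auxiliary step `isAlgebraic_three`: is Algebraic three. [bookkeeping] -/
theorem isAlgebraic_three : IsAlgebraic ℚ (3:ℝ) := by
  simpa using isAlgebraic_ratCast 3

/-- Auxiliary step `bcl_third_one`: bcl third one. [bookkeeping] -/
theorem bcl_third_one : bcl (1/3) 1 = kcQ 3 := by
  rw [bcl_rat_one (1/3) (by norm_num), kcQ]; exact kc_congr _ _ (by norm_num)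

/-- Auxiliary step `bcl_one_third`: bcl one third. [bookkeeping] -/
theorem bcl_one_third : bcl 1 (1/3) = kcQ 3 := by
  rw [bcl_symm betaReflectionMove_holds 1 (1/3) one_pos (by norm_num), bcl_third_one]

/-- Auxiliary step `bcl_twoThirds_one`: bcl two Thirds one. [bookkeeping] -/
theorem bcl_twoThirds_one : bcl (2/3) 1 = kcQ (3/2) := by
  rw [bcl_rat_one (2/3) (by norm_num), kcQ]; exact kc_congr _ _ (by norm_num)

/-- Auxiliary step `bcl_one_twoThirds`: bcl one two Thirds. [bookkeeping] -/
theorem bcl_one_twoThirds : bcl 1 (2/3) = kcQ (3/2) := by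
  rw [bcl_symm betaReflectionMove_holds 1 (2/3) one_pos (by norm_num), bcl_twoThirds_one]

/-- Auxiliary step `bcl_twoThirds_third`: bcl two Thirds third. [bookkeeping] -/
theorem bcl_twoThirds_third : bcl (2/3) (1/3) = bcl (1/3) (2/3) :=
  bcl_symm betaReflectionMove_holds (2/3) (1/3) (by norm_num) (by norm_num)

/-- Auxiliary step `bcl_one_one'`: bcl one one'. [bookkeeping] -/
theorem bcl_one_one' : bcl 1 1 = kcQ 1 := by rw [bcl_one_one, kcQ_one]

/-- Auxiliary step `lvl_three_val`: lvl three val. [bookkeeping] -/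
theorem lvl_three_val {k : ℕ} (w : Fin k → Fin 3) (i : Fin k) :
    lvl 3 w i = if (w i).val = 0 then 1/3 else if (w i).val = 1 then 2/3 else 1 := by
  unfold lvl
  have hlt := (w i).isLt
  split_ifs with h0 h1
  · rw [h0]; norm_num
  · rw [h1]; norm_num
  · have h2 : (w i).val = 2 := by omega
    rw [h2]; norm_num

/-- **The level-3 letters in `P`**: `β((x+1)/3,(y+1)/3) = κ(c_{xy}) · X^{[X-letter]} · Y^{[Y-letter]} · Z^{[Z-letter]}`. [this node] -/
theorem letter_three {k : ℕ} (u v : Fin k → Fin 3) (i : Fin k) :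
    bcl (lvl 3 u i) (lvl 3 v i) = kcQ (cst3 (u i) (v i)) * bcl (1/3) (2/3) ^ xExp3 (u i) (v i)
      * bcl (1/3) (1/3) ^ yExp3 (u i) (v i) * bcl (2/3) (2/3) ^ zExp3 (u i) (v i) := by
  rw [lvl_three_val u i, lvl_three_val v i]
  have hu := (u i).isLt
  have hv := (v i).isLt
  have hu' : (u i).val = 0 ∨ (u i).val = 1 ∨ (u i).val = 2 := by omega
  have hv' : (v i).val = 0 ∨ (v i).val = 1 ∨ (v i).val = 2 := by omega
  rcases hu' with h | h | h <;> rcases hv' with h' | h' | h' <;>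
    simp only [h, h', cst3, xExp3, yExp3, zExp3, if_true, if_false, and_true, and_false,
      or_false, or_true, pow_one, pow_zero, mul_one, one_mul, kcQ_one,
      show (0:ℕ) ≠ 1 from by decide, show (0:ℕ) ≠ 2 from by decide, show (1:ℕ) ≠ 0 from by decide,
      show (1:ℕ) ≠ 2 from by decide, show (2:ℕ) ≠ 0 from by decide, show (2:ℕ) ≠ 1 from by decide,
      bcl_twoThirds_third, bcl_third_one, bcl_one_third, bcl_twoThirds_one, bcl_one_twoThirds, bcl_one_one]

/-- **A level-3 word in `P`**: `∏ᵢ β = κ(∏ c) · X^{#X} · Y^{#Y} · Z^{#Z}`. [this node] -/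
theorem word_class_three {k : ℕ} (u v : Fin k → Fin 3) :
    ∏ i, bcl (lvl 3 u i) (lvl 3 v i)
      = kcQ (cstW3 u v) * bcl (1/3) (2/3) ^ xCount3 u v * bcl (1/3) (1/3) ^ yCount3 u v
        * bcl (2/3) (2/3) ^ zCount3 u v := by
  simp_rw [letter_three u v]
  rw [Finset.prod_mul_distrib, Finset.prod_mul_distrib, Finset.prod_mul_distrib, Finset.prod_pow_eq_pow_sum,
    Finset.prod_pow_eq_pow_sum, Finset.prod_pow_eq_pow_sum, kcQ_prod]
  rfl

/-- **Values of level-3 words**: `∏ᵢ B = (∏ c) · B(⅓,⅔)^{#X} · B(⅓,⅓)^{#Y} · B(⅔,⅔)^{#Z}`. [this node] -/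
theorem prod_bval_three {k : ℕ} (u v : Fin k → Fin 3) :
    ∏ i, bval (lvl 3 u i) (lvl 3 v i)
      = (cstW3 u v : ℝ) * bval (1/3) (2/3) ^ xCount3 u v * bval (1/3) (1/3) ^ yCount3 u v
        * bval (2/3) (2/3) ^ zCount3 u v := by
  have h := congrArg KZ.evalP (word_class_three u v)
  rw [map_prod, map_mul, map_mul, map_mul, map_pow, map_pow, map_pow, evalP_kcQ] at h
  exact h

/-- **The Dirichlet relation in `P`**: `β(⅓,⅓)·β(⅔,⅔) = κ(3)·β(⅓,⅔)` — the move at `(a,b,c) = (⅓,⅓,⅔)` read through `word_class`,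
then the unit letter `β(⅓,1) = κ(3)`. [this node] -/
theorem dirichlet_rel (hD : BetaDirichletMove) :
    bcl (1/3) (1/3) * bcl (2/3) (2/3) = kcQ 3 * bcl (1/3) (2/3) := by
  have hab : ∀ j : Fin 2, 0 < (![(1:ℚ)/3, 1/3 + 1/3] : Fin 2 → ℚ) j ∧ 0 < (![(1:ℚ)/3, 2/3] : Fin 2 → ℚ) j := by
    intro j; fin_cases j <;> norm_num
  have hab' : ∀ j : Fin 2, 0 < (![(1:ℚ)/3, 1/3] : Fin 2 → ℚ) j ∧ 0 < (![(2:ℚ)/3, 1/3 + 2/3] : Fin 2 → ℚ) j := by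
    intro j; fin_cases j <;> norm_num
  obtain ⟨ρ, hρd, hρi⟩ := KZ.exists_cubeBetaRep (![(1:ℚ)/3, 1/3 + 1/3] : Fin 2 → ℚ) ![(1:ℚ)/3, 2/3] hab
  obtain ⟨ρ', hρ'd, hρ'i⟩ := KZ.exists_cubeBetaRep (![(1:ℚ)/3, 1/3] : Fin 2 → ℚ) ![(2:ℚ)/3, 1/3 + 2/3] hab'
  have he : KZ.Equivalent ρ ρ' :=
    hD (1/3) (1/3) (2/3) (by norm_num) (by norm_num) (by norm_num) ρ ρ' hρd hρi hρ'd hρ'i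
  have e := he.toFormalPeriod_eq
  rw [word_class _ _ hab ρ hρd hρi, word_class _ _ hab' ρ' hρ'd hρ'i] at e
  simp only [Fin.prod_univ_two, Matrix.cons_val_zero, Matrix.cons_val_one] at e
  rw [show (1/3 : ℚ) + 1/3 = 2/3 by norm_num, show (1/3 : ℚ) + 2/3 = 1 by norm_num, bcl_third_one] at e
  rw [e, mul_comm]

/-- … and on values: `B(⅓,⅓)·B(⅔,⅔) = 3·B(⅓,⅔)` (read through `evalP`; as a real identity it is `dirichlet_third` of
`DirichletMove.lean`, provable without the move). [this node] -/
theorem dirichlet_rel_values (hD : BetaDirichletMove) :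
    bval (1/3) (1/3) * bval (2/3) (2/3) = 3 * bval (1/3) (2/3) := by
  have h := congrArg KZ.evalP (dirichlet_rel hD)
  rw [map_mul, map_mul, evalP_kcQ, show ((3:ℚ):ℝ) = 3 by norm_num] at h
  exact h

/-! #### DKO type 0 at level 3 in terms of letter counts -/

/-- Auxiliary step `letterMult_three_one`: letter Mult three one. [bookkeeping] -/
theorem letterMult_three_one (x y : Fin 3) :
    letterMult 3 x y 1 = 2 * (yExp3 x y : ℤ) + xExp3 x y - zExp3 x y := by
  fin_cases x <;> fin_cases y <;> decide

/-- Auxiliary step `letterMult_three_two`: letter Mult three two. [bookkeeping] -/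
theorem letterMult_three_two (x y : Fin 3) :
    letterMult 3 x y 2 = 2 * (zExp3 x y : ℤ) + xExp3 x y - yExp3 x y := by
  fin_cases x <;> fin_cases y <;> decide

/-- Auxiliary step `pairMult_three_one`: pair Mult three one. [bookkeeping] -/
theorem pairMult_three_one {k : ℕ} (u v u' v' : Fin k → Fin 3) :
    pairMult 3 u v u' v' 1
      = (2 * (yCount3 u v : ℤ) + xCount3 u v - zCount3 u v) - (2 * (yCount3 u' v' : ℤ) + xCount3 u' v' - zCount3 u' v') := by
  simp only [pairMult, letterMult_three_one, xCount3, yCount3, zCount3, Nat.cast_sum, Finset.sum_add_distrib,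
    Finset.sum_sub_distrib, Finset.mul_sum]

/-- Auxiliary step `pairMult_three_two`: pair Mult three two. [bookkeeping] -/
theorem pairMult_three_two {k : ℕ} (u v u' v' : Fin k → Fin 3) :
    pairMult 3 u v u' v' 2
      = (2 * (zCount3 u v : ℤ) + xCount3 u v - yCount3 u v) - (2 * (zCount3 u' v' : ℤ) + xCount3 u' v' - yCount3 u' v') := by
  simp only [pairMult, letterMult_three_two, xCount3, yCount3, zCount3, Nat.cast_sum, Finset.sum_add_distrib,
    Finset.sum_sub_distrib, Finset.mul_sum]

/-- Auxiliary step `fract_three`: fract three. [bookkeeping] -/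
theorem fract_three (w i : ℕ) :
    Int.fract ((w : ℚ) * (i : ℚ) / ((3 : ℕ) : ℚ)) = (((w * i) % 3 : ℕ) : ℚ) / ((3 : ℕ) : ℚ) := by
  rw [show (w : ℚ) * (i : ℚ) / ((3 : ℕ) : ℚ) = ((w * i : ℕ) : ℚ) / ((3 : ℕ) : ℚ) by push_cast; ring]
  exact Int.fract_div_natCast_eq_div_natCast_mod

/-- At level 3 a Γ-vector has DKO type 0 iff it vanishes on `{1,2}`. [this node] -/
theorem hodgeType_three_iff (p : ℕ → ℤ) : IsHodgeTypeGammaMonomial 3 p 0 ↔ (p 1 = 0 ∧ p 2 = 0) := by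
  constructor
  · intro h
    have e1 := h 1 (by decide)
    have e2 := h 2 (by decide)
    rw [sum_Ico_one_three, fract_three, fract_three] at e1 e2
    norm_num at e1 e2
    have i1 : ((p 1 : ℤ) : ℚ) = 0 := by linear_combination 2 * e2 - e1
    have i2 : ((p 2 : ℤ) : ℚ) = 0 := by linear_combination 2 * e1 - e2
    exact ⟨by exact_mod_cast i1, by exact_mod_cast i2⟩
  · rintro ⟨h1, h2⟩ w _
    rw [sum_Ico_one_three, h1, h2]
    simp

/-- **DKO type 0 at level 3 = two count identities**: `#X + #Z` and `#Y − #Z` agree. [this node] -/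
theorem sameType_three_iff {k : ℕ} (u v u' v' : Fin k → Fin 3) :
    SameType 3 u v u' v' ↔
      (xCount3 u v + zCount3 u v = xCount3 u' v' + zCount3 u' v' ∧
        yCount3 u v + zCount3 u' v' = yCount3 u' v' + zCount3 u v) := by
  unfold SameType
  rw [hodgeType_three_iff, pairMult_three_one, pairMult_three_two]
  omega

/-! #### the normal-form identity in a commutative ring with `Y Z = T X` -/

/-- If `Y·Z = T·X`, `x+z = x'+z'` and `y−z = y'−z'`, then `T^{z'}·X^x Y^y Z^z = T^{z}·X^{x'} Y^{y'} Z^{z'}`. [folklore] -/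
theorem nf3 {M : Type*} [CommRing M] {X Y Z T : M} (hrel : Y * Z = T * X) {x y z x' y' z' : ℕ}
    (hxz : x + z = x' + z') (hyz : y + z' = y' + z) :
    T ^ z' * (X ^ x * Y ^ y * Z ^ z) = T ^ z * (X ^ x' * Y ^ y' * Z ^ z') := by
  have red : ∀ (p q d : ℕ), X ^ p * Y ^ (q + d) * Z ^ q = T ^ q * X ^ (p + q) * Y ^ d := by
    intro p q d
    rw [pow_add, pow_add, show X ^ p * (Y ^ q * Y ^ d) * Z ^ q = X ^ p * Y ^ d * (Y * Z) ^ q by rw [mul_pow]; ring,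
      hrel, mul_pow]
    ring
  have red' : ∀ (p q d : ℕ), X ^ p * Y ^ q * Z ^ (q + d) = T ^ q * X ^ (p + q) * Z ^ d := by
    intro p q d
    rw [pow_add, pow_add, show X ^ p * Y ^ q * (Z ^ q * Z ^ d) = X ^ p * Z ^ d * (Y * Z) ^ q by rw [mul_pow]; ring,
      hrel, mul_pow]
    ring
  rcases le_total z y with hzy | hyz'
  · obtain ⟨d, rfl⟩ := Nat.exists_eq_add_of_le hzy
    obtain ⟨d', hd'⟩ : ∃ d', y' = z' + d' := ⟨y' - z', by omega⟩
    have hdd : d' = d := by omega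
    subst hdd; subst hd'
    rw [red x z d', red x' z' d', hxz]; ring
  · obtain ⟨d, rfl⟩ := Nat.exists_eq_add_of_le hyz'
    obtain ⟨d', hd'⟩ : ∃ d', z' = y' + d' := ⟨z' - y', by omega⟩
    have hdd : d' = d := by omega
    subst hdd; subst hd'
    rw [red' x y d', red' x' y' d', show x + y = x' + y' by omega]; ring

/-! #### the chain theorem -/

end LevelThreeChains
end Summit.KontsevichZagierPeriods.FermatIsogeny.DeepTargets
end
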